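import Summits.CriticalPhenomena.PercolationContinuityZ3.Theorems.PercNearOneGluingNoHeavyLowerTailSahiHittingCoreTrace
import Summits.CriticalPhenomena.PercolationContinuityZ3.Theorems.PercNearOneGluingNoHeavyLowerTailSahiHittingPercolationAllOrders
import HarnessLib

/-!
# `NoHeavyLowerTail` (stmt-CriticalPhenomena-4575) — core-trace reduction for hitting events on ANY product space; bond percolation on any graph

Support file, seat `prim-l12-p5` (gen 8), `--supports stmt-CriticalPhenomena-4575`.  No definitions, no named facts, no sorries, standard axioms.
Transports the finite-cube theorems of `…SahiHittingCoreTrace` (core-trace reduction: only the SHARED coins of a hitting family matter; trace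
width ≤ 3; sunflowers with an arbitrary kernel; nested kernels) to `msahiE (prodBernoulli p)` on an ARBITRARY index type (gen 7's bridge
`msahiE_prodBernoulli_hit_eq_sahiE`: finitely many hitting events live on the finite cube of the coins they mention), to Mathlib's `setBer(u,p)`,
and to bond percolation `bondPercolation G p` on any graph ("some edge of `F_l` is open", edge sets with a common kernel and private petals).
(Index types in `Type`: the private-coordinate elimination of the `prim-masterthm` lane used by `…SahiHittingCoreTrace` is stated there.)
-/

noncomputable section

open scoped Classical

namespace Summit.CriticalPhenomena.PercolationContinuityZ3.Theorems

namespace SahiHitting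

open MeasureTheory ProbabilityTheory Finset Function Literature.Combinatorics.Sahi2008
open Literature.Probability.Percolation (bondPercolation BondConfig)
open Literature.Probability.Percolation.DecisionTree (ind ind_of_mem ind_of_not_mem ind_nonneg)
open Literature.Probability.LatticeModels (prodBernoulli prodBernoulli_indicator_holds)

variable {ι : Type}

/-- **Core-trace reduction with trace width ≤ 3, ANY product space.**  `p : ι → [0,1]` on an arbitrary index type; finite sets
`A_l ⊇ K_l` whose differences are private (a coin of `A_l ∖ K_l` lies in no other `A_{l'}`); if among any four indices two carry nested traces
`K_i ⊆ K_j`, then `0 ≤ E_m^{prodBernoulli p}(1_{H_{A_0}},…,1_{H_{A_{m−1}}})`. [this work] -/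
theorem msahiE_prodBernoulli_hit_nonneg_of_core_width_le_three (p : ι → unitInterval) (m : ℕ) (A K : Fin m → Finset ι)
    (hKA : ∀ l, K l ⊆ A l) (hpriv : ∀ l, ∀ a ∈ A l, a ∉ K l → ∀ l', l' ≠ l → a ∉ A l')
    (hw : ∀ S : Finset (Fin m), S.card = 4 → ∃ i ∈ S, ∃ j ∈ S, i ≠ j ∧ K i ⊆ K j) :
    0 ≤ msahiE (prodBernoulli p) m (fun l => ind {ω : Set ι | ∃ a ∈ A l, a ∈ ω}) := by
  let U : Finset ι := Finset.univ.biUnion A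
  have hA : ∀ l, A l ⊆ U := fun l => Finset.subset_biUnion_of_mem A (Finset.mem_univ l)
  rw [msahiE_prodBernoulli_hit_eq_sahiE p U m A hA]
  refine prodBernoulli_sahiE_hit_nonneg_of_core_width_le_three _ m _ (fun l => (K l).subtype (· ∈ U))
    (fun l => subtype_subset_subtype_of_subset (hKA l)) (fun l a ha haK l' hl' ha' => ?_) (fun S hS => ?_)
  · rw [Finset.mem_subtype] at ha ha' haK
    exact hpriv l a ha haK l' hl' ha'
  · obtain ⟨i, hi, j, hj, hij, hsub⟩ := hw S hS
    exact ⟨i, hi, j, hj, hij, subtype_subset_subtype_of_subset hsub⟩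

/-- **Sunflowers, any kernel, any petals, every order, ANY product space.**  `C ⊆ A_l` for all `l` and every pairwise intersection inside `C`:
`0 ≤ E_m^{prodBernoulli p}(1_{H_{A_0}},…,1_{H_{A_{m−1}}})`. [this work] -/
theorem msahiE_prodBernoulli_hit_nonneg_of_sunflower (p : ι → unitInterval) (m : ℕ) (A : Fin m → Finset ι) (C : Finset ι)
    (hC : ∀ l, C ⊆ A l) (hpet : ∀ i j, i ≠ j → ∀ a ∈ A i, a ∈ A j → a ∈ C) :
    0 ≤ msahiE (prodBernoulli p) m (fun l => ind {ω : Set ι | ∃ a ∈ A l, a ∈ ω}) := by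
  refine msahiE_prodBernoulli_hit_nonneg_of_core_width_le_three p m A (fun _ => C) hC
    (fun l a ha haC l' hl' ha' => haC (hpet l l' (Ne.symm hl') a ha ha')) fun S hS => ?_
  obtain ⟨i, hi, j, hj, hij⟩ := Finset.one_lt_card.mp (by omega : 1 < S.card)
  exact ⟨i, hi, j, hj, hij, subset_rfl⟩

/-- **Nested kernels, every order, ANY product space.** [this work] -/
theorem msahiE_prodBernoulli_hit_nonneg_of_nested_kernels (p : ι → unitInterval) (m : ℕ) (A K : Fin m → Finset ι)
    (hKA : ∀ l, K l ⊆ A l) (hpriv : ∀ l, ∀ a ∈ A l, a ∉ K l → ∀ l', l' ≠ l → a ∉ A l')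
    (hchain : ∀ i j, K i ⊆ K j ∨ K j ⊆ K i) :
    0 ≤ msahiE (prodBernoulli p) m (fun l => ind {ω : Set ι | ∃ a ∈ A l, a ∈ ω}) := by
  refine msahiE_prodBernoulli_hit_nonneg_of_core_width_le_three p m A K hKA hpriv fun S hS => ?_
  obtain ⟨i, hi, j, hj, hij⟩ := Finset.one_lt_card.mp (by omega : 1 < S.card)
  rcases hchain i j with h | h
  · exact ⟨i, hi, j, hj, hij, h⟩
  · exact ⟨j, hj, i, hi, hij.symm, h⟩

/-! ### Mathlib's homogeneous `setBer(u, p)` -/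

/-- **`setBer(u,p)` form of the sunflower theorem.** [this work; cite: Grimmett1999, §1.3] -/
theorem setBernoulli_msahiE_hit_nonneg_of_sunflower (u : Set ι) (p : unitInterval) (m : ℕ) (A : Fin m → Finset ι) (C : Finset ι)
    (hC : ∀ l, C ⊆ A l) (hpet : ∀ i j, i ≠ j → ∀ a ∈ A i, a ∈ A j → a ∈ C) :
    0 ≤ msahiE setBer(u, p) m (fun l => ind {ω : Set ι | ∃ a ∈ A l, a ∈ ω}) := by
  rw [← prodBernoulli_indicator_holds u p]
  exact msahiE_prodBernoulli_hit_nonneg_of_sunflower _ m A C hC hpet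

/-! ### Bond percolation on any graph -/

variable {V : Type}

/-- **Bond percolation on ANY graph, every order: edge sets with a common kernel.**  For finite edge sets `F_l ⊇ C` whose pairwise
intersections lie in `C` ("sunflower of edge sets", arbitrary kernel `C`, arbitrary private petals), `0 ≤ E_m({some edge of F_l open}_l)` under
`bondPercolation G p`. [this work; cite: Kahn2022, Conj. 5 (arXiv p. 3); Grimmett1999, §1.3] -/
theorem msahiE_bondPercolation_someOpen_nonneg_of_sunflower (G : SimpleGraph V) (p : unitInterval) (m : ℕ)
    (F : Fin m → Finset (Sym2 V)) (C : Finset (Sym2 V)) (hC : ∀ l, C ⊆ F l) (hpet : ∀ i j, i ≠ j → ∀ e ∈ F i, e ∈ F j → e ∈ C) :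
    0 ≤ msahiE (bondPercolation G p) m (fun l => ind {ω : BondConfig V | ∃ e ∈ F l, e ∈ ω}) := by
  unfold bondPercolation
  exact setBernoulli_msahiE_hit_nonneg_of_sunflower _ p m F C hC hpet

/-- **Bond percolation on ANY graph, every order: trace width ≤ 3.**  Edge sets `F_l ⊇ K_l` with private differences (an edge of `F_l ∖ K_l`
lies in no other `F_{l'}`) and, among any four indices, two nested traces `K_i ⊆ K_j`: `0 ≤ E_m({some edge of F_l open}_l)`. [this work] -/
theorem msahiE_bondPercolation_someOpen_nonneg_of_core_width_le_three (G : SimpleGraph V) (p : unitInterval) (m : ℕ)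
    (F K : Fin m → Finset (Sym2 V)) (hKF : ∀ l, K l ⊆ F l) (hpriv : ∀ l, ∀ e ∈ F l, e ∉ K l → ∀ l', l' ≠ l → e ∉ F l')
    (hw : ∀ S : Finset (Fin m), S.card = 4 → ∃ i ∈ S, ∃ j ∈ S, i ≠ j ∧ K i ⊆ K j) :
    0 ≤ msahiE (bondPercolation G p) m (fun l => ind {ω : BondConfig V | ∃ e ∈ F l, e ∈ ω}) := by
  unfold bondPercolation
  rw [← prodBernoulli_indicator_holds]
  exact msahiE_prodBernoulli_hit_nonneg_of_core_width_le_three _ m F K hKF hpriv hw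

end SahiHitting

end Summit.CriticalPhenomena.PercolationContinuityZ3.Theorems

end
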